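import Summits.QuantumAdvantage.QuantumAdvantage.Theorems.AnchorDialFibre

/-!
# AnchorDial — Step (cell decomp-qadv, seat lens-2, generation 14 rev 4; supports item 26531 `ExactnessDial.PolyLossOddU3`)

§12a (second half) + §12b (start) of the node (rev 4): the fibre-wise Smolensky step **`fibre_step`**, the block step **`step_le`** and
`step_two_sided` (VENDORED verbatim from g13 `HolonomyDial.lean` v6 §H5/§H6 = g13 tree parts `HolonomyDialFibre` / `HolonomyDialChain`),
and the NEW five-block chain **`chain5`**: five pairwise disjoint free odd blocks, a side condition blind to all of them, `K = 2^47`: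
`32K·#{P = 1 ∧ R ∧ B₀ ∧ … ∧ B₄} ≤ K·#{P = 1 ∧ R} + 31·2^N`.

Split (≤ 400 lines, part 9/10) of the node file `HOME/decomp-qadv-lens-2/g14/AnchorDial.lean` (rev 4; sha256 in SHA256SUMS.txt, farm rc 0, no
placeholders); declarations verbatim, namespace `Summit.QuantumAdvantage.QuantumAdvantage.Theorems.AnchorDial`.  Record: NODE-g14.md.
-/

set_option linter.dupNamespace false
set_option linter.unusedVariables false

noncomputable section

open scoped Classical

namespace Summit.QuantumAdvantage.QuantumAdvantage.Theorems.AnchorDial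

open Finset
open Literature.Computability.QuantumComplexity Literature.Computability.QuantumComplexity.RingHLF
open Literature.Computability.MetaComplexity Literature.Computability.MetaComplexity.Smolensky
open Summit.QuantumAdvantage.AdviceFreeQNC0
open Summit.QuantumAdvantage.QuantumAdvantage.Theses (ExactnessDial.PolyLossOddU3 ExactnessDial.DPLift3)

variable {N : ℕ}

section StepV

/-- **fibre-wise Smolensky step**: on one free odd block, a low-degree event meets both zero-sign classes almost
equally often: `#{G = 1, sign = τ} ≤ #{G = 1, sign = -τ} + 2D·C(m, m/2)`. -/
theorem fibre_step {m D : ℕ} (hm : Odd m) (hm3 : 3 ≤ m) {G : CubeFn (ZMod 3) m} (hG : G ∈ lowDeg (ZMod 3) m D)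
    (τ : ZMod 3) (hτ : τ = 1 ∨ τ = -1) :
    (univ.filter fun w => G w = 1 ∧ wsgn w = τ).card ≤
      (univ.filter fun w => G w = 1 ∧ wsgn w = -τ).card + (D + D) * m.choose (m / 2) := by
  have hH : (τ • (1 + indP G 1) : CubeFn (ZMod 3) m) ∈ lowDeg (ZMod 3) m (D + D) :=
    Submodule.smul_mem _ _ (Submodule.add_mem _ (one_mem_lowDeg _) (indP_mem hG 1))
  have hS : (univ.filter fun w : Fin m → Bool => omMono (2 : ZMod 3) univ w = (τ • (1 + indP G 1) : CubeFn (ZMod 3) m) w).card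
      ≤ 2 ^ (m - 1) + (D + D) * m.choose (m / 2) := by
    convert card_filter_omMono_eq_le hm (ω := (2 : ZMod 3)) (by decide) (by decide) hH
  have key : ∀ w : Fin m → Bool, omMono (2 : ZMod 3) univ w = -wsgn w := by
    intro w; rw [wsgn_eq w, Odd.neg_one_pow hm]; ring
  have hsub : (univ.filter fun w => G w = 1 ∧ wsgn w = τ).card + (univ.filter fun w => ¬ G w = 1 ∧ wsgn w = -τ).card ≤
      (univ.filter fun w : Fin m → Bool => omMono (2 : ZMod 3) univ w = (τ • (1 + indP G 1) : CubeFn (ZMod 3) m) w).card := by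
    rw [← Finset.card_union_of_disjoint (Finset.disjoint_filter.2 fun w _ h1 h2 => h2.1 h1.1)]
    refine card_le_card fun w hw => ?_
    rw [mem_union, mem_filter, mem_filter] at hw
    rw [mem_filter]
    refine ⟨mem_univ _, ?_⟩
    simp only [Pi.smul_apply, Pi.add_apply, Pi.one_apply, indP_apply, smul_eq_mul]
    rcases hw with ⟨_, hG1, hs⟩ | ⟨_, hG1, hs⟩
    · rw [if_pos hG1, key, hs]
      rcases hτ with rfl | rfl <;> decide
    · rw [if_neg hG1, key, hs]; ring
  have hhalf := half_le_card_wsgn hm3 (-τ) (by rcases hτ with rfl | rfl <;> simp)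
  have hsplit : (univ.filter fun w : Fin m → Bool => wsgn w = -τ).card ≤
      (univ.filter fun w => G w = 1 ∧ wsgn w = -τ).card + (univ.filter fun w => ¬ G w = 1 ∧ wsgn w = -τ).card := by
    rw [← Finset.card_union_of_disjoint (Finset.disjoint_filter.2 fun w _ h1 h2 => h2.1 h1.1)]
    refine card_le_card fun w hw => ?_
    rw [mem_filter] at hw
    rw [mem_union, mem_filter, mem_filter]
    by_cases h : G w = 1
    · exact Or.inl ⟨mem_univ _, h, hw.2⟩
    · exact Or.inr ⟨mem_univ _, h, hw.2⟩
  omega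

/-- **STEP**: freeing one odd block, a low-degree event split by that block's sign is balanced up to `2^N / K`
(block-blind side condition `R`; `K·2D·C(m,m/2) ≤ 2^m`). -/
theorem step_le {s m D K : ℕ} (hsm : s + m ≤ N) (hm : Odd m) (hm3 : 3 ≤ m)
    (hK : K * ((D + D) * m.choose (m / 2)) ≤ 2 ^ m)
    {P : CubeFn (ZMod 3) N} (hP : P ∈ lowDeg (ZMod 3) N D)
    (R : (Fin N → Bool) → Prop) [DecidablePred R] (hR : ∀ ρ (w w' : Fin m → Bool), R (joinAt s m ρ w) → R (joinAt s m ρ w'))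
    (τ : ZMod 3) (hτ : τ = 1 ∨ τ = -1) :
    K * (univ.filter fun x => P x = 1 ∧ R x ∧ bsgn s m x = τ).card ≤
      K * (univ.filter fun x => P x = 1 ∧ R x ∧ bsgn s m x = -τ).card + 2 ^ N := by
  have hA := card_fibre hsm (fun x => P x = 1 ∧ R x ∧ bsgn s m x = τ)
  have hB := card_fibre hsm (fun x => P x = 1 ∧ R x ∧ bsgn s m x = -τ)
  have hfib : ∀ ρ : Fin N → Bool,
      (univ.filter fun w : Fin m → Bool =>
          P (joinAt s m ρ w) = 1 ∧ R (joinAt s m ρ w) ∧ bsgn s m (joinAt s m ρ w) = τ).card ≤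
      (univ.filter fun w : Fin m → Bool =>
          P (joinAt s m ρ w) = 1 ∧ R (joinAt s m ρ w) ∧ bsgn s m (joinAt s m ρ w) = -τ).card
        + (D + D) * m.choose (m / 2) := by
    intro ρ
    by_cases hRρ : R (joinAt s m ρ (fun _ => false))
    · have hRall : ∀ w, R (joinAt s m ρ w) := fun w => hR ρ _ _ hRρ
      have hG : (fun w => P (joinAt s m ρ w)) ∈ lowDeg (ZMod 3) m D := joinAt_comp_mem ρ hP
      have h := fibre_step hm hm3 hG τ hτ
      have e1 : (univ.filter fun w : Fin m → Bool =>
            P (joinAt s m ρ w) = 1 ∧ R (joinAt s m ρ w) ∧ bsgn s m (joinAt s m ρ w) = τ) =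
          univ.filter fun w => (fun w => P (joinAt s m ρ w)) w = 1 ∧ wsgn w = τ := by
        refine filter_congr fun w _ => ?_
        rw [bsgn_joinAt hsm]
        exact ⟨fun h => ⟨h.1, h.2.2⟩, fun h => ⟨h.1, hRall w, h.2⟩⟩
      have e2 : (univ.filter fun w : Fin m → Bool =>
            P (joinAt s m ρ w) = 1 ∧ R (joinAt s m ρ w) ∧ bsgn s m (joinAt s m ρ w) = -τ) =
          univ.filter fun w => (fun w => P (joinAt s m ρ w)) w = 1 ∧ wsgn w = -τ := by
        refine filter_congr fun w _ => ?_
        rw [bsgn_joinAt hsm]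
        exact ⟨fun h => ⟨h.1, h.2.2⟩, fun h => ⟨h.1, hRall w, h.2⟩⟩
      rw [e1, e2]; exact h
    · have hRnone : ∀ w, ¬ R (joinAt s m ρ w) := fun w h => hRρ (hR ρ _ _ h)
      have e1 : (univ.filter fun w : Fin m → Bool =>
            P (joinAt s m ρ w) = 1 ∧ R (joinAt s m ρ w) ∧ bsgn s m (joinAt s m ρ w) = τ) = ∅ :=
        filter_eq_empty_iff.2 fun w _ h => hRnone w h.2.1
      rw [e1, card_empty]; exact Nat.zero_le _
  have hsum := Finset.sum_le_sum fun ρ (_ : ρ ∈ (univ : Finset (Fin N → Bool))) => hfib ρ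
  rw [Finset.sum_add_distrib, Finset.sum_const, card_univ, smul_eq_mul, ← hA, ← hB] at hsum
  have hcard : Fintype.card (Fin N → Bool) = 2 ^ N := by simp
  rw [hcard] at hsum
  set A := (univ.filter fun x => P x = 1 ∧ R x ∧ bsgn s m x = τ).card
  set B := (univ.filter fun x => P x = 1 ∧ R x ∧ bsgn s m x = -τ).card
  set c := (D + D) * m.choose (m / 2)
  have e1 : K * (2 ^ m * A) ≤ K * (2 ^ m * B) + 2 ^ N * (K * c) := by
    calc K * (2 ^ m * A) ≤ K * (2 ^ m * B + 2 ^ N * c) := Nat.mul_le_mul_left K hsum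
      _ = K * (2 ^ m * B) + 2 ^ N * (K * c) := by ring
  have e2 : 2 ^ N * (K * c) ≤ 2 ^ N * 2 ^ m := Nat.mul_le_mul_left _ hK
  have e3 : 2 ^ m * (K * A) ≤ 2 ^ m * (K * B + 2 ^ N) := by
    calc 2 ^ m * (K * A) = K * (2 ^ m * A) := by ring
      _ ≤ K * (2 ^ m * B) + 2 ^ N * (K * c) := e1
      _ ≤ K * (2 ^ m * B) + 2 ^ N * 2 ^ m := Nat.add_le_add_left e2 _
      _ = 2 ^ m * (K * B + 2 ^ N) := by ring
  exact Nat.le_of_mul_le_mul_left e3 (Nat.two_pow_pos m)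

/-- the two-sided form used in the chain: with `T = A + B`, `2KA ≤ KT + 2^N` and `KT ≤ 2KA + 2^N`
(stated for the AnchorDial copies `AnchorDial.joinAt` / `AnchorDial.bsgn` of the g13 fibre objects landed in part 8;
the HolonomyDial original is `HolonomyDial.step_two_sided`). -/
theorem step_two_sided {s m D K : ℕ} (hsm : s + m ≤ N) (hm : Odd m) (hm3 : 3 ≤ m)
    (hK : K * ((D + D) * m.choose (m / 2)) ≤ 2 ^ m)
    {P : CubeFn (ZMod 3) N} (hP : P ∈ lowDeg (ZMod 3) N D)
    (R : (Fin N → Bool) → Prop) [DecidablePred R] (hR : ∀ ρ (w w' : Fin m → Bool), R (AnchorDial.joinAt s m ρ w) → R (AnchorDial.joinAt s m ρ w'))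
    (τ : ZMod 3) (hτ : τ = 1 ∨ τ = -1) :
    K * (2 * (univ.filter fun x => P x = 1 ∧ R x ∧ AnchorDial.bsgn s m x = τ).card) ≤
      K * (univ.filter fun x => P x = 1 ∧ R x).card + 2 ^ N ∧
    K * (univ.filter fun x => P x = 1 ∧ R x).card ≤
      K * (2 * (univ.filter fun x => P x = 1 ∧ R x ∧ AnchorDial.bsgn s m x = τ).card) + 2 ^ N := by
  have h1 := step_le hsm hm hm3 hK hP R hR τ hτ
  have h2 := step_le hsm hm hm3 hK hP R hR (-τ) (by rcases hτ with rfl | rfl <;> simp)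
  rw [neg_neg] at h2
  have hsplit : (univ.filter fun x => P x = 1 ∧ R x).card =
      (univ.filter fun x => P x = 1 ∧ R x ∧ bsgn s m x = τ).card +
        (univ.filter fun x => P x = 1 ∧ R x ∧ bsgn s m x = -τ).card := by
    rw [← Finset.card_union_of_disjoint (Finset.disjoint_filter.2 fun x _ ha hb => by
      rw [ha.2.2] at hb; rcases hτ with rfl | rfl <;> exact absurd hb.2.2 (by decide))]
    congr 1
    ext x
    rw [mem_union, mem_filter, mem_filter, mem_filter]
    constructor
    · rintro ⟨_, hp, hr⟩
      rcases bsgn_cases s m x with h | h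
      · rcases hτ with rfl | rfl
        · exact Or.inl ⟨mem_univ _, hp, hr, h⟩
        · exact Or.inr ⟨mem_univ _, hp, hr, by rw [h]; ring⟩
      · rcases hτ with rfl | rfl
        · exact Or.inr ⟨mem_univ _, hp, hr, h⟩
        · exact Or.inl ⟨mem_univ _, hp, hr, h⟩
    · rintro (⟨_, hp, hr, _⟩ | ⟨_, hp, hr, _⟩) <;> exact ⟨mem_univ _, hp, hr⟩
  rw [hsplit]
  constructor
  · have := h1; nlinarith [this]
  · nlinarith [h2]


end StepV

/-! ### §12b the five-block chain and `Equi5` -/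

section Chain5

/-- **five halving steps** over five pairwise disjoint free blocks `[sⱼ, sⱼ + m)` (in increasing order) with a
side condition `R` blind to all five blocks: `32K·#{P ∧ R ∧ B₀ ∧ … ∧ B₄} ≤ K·#{P ∧ R} + 31·2^N` (`K = 2^47`). -/
theorem chain5 {s0 s1 s2 s3 s4 m D : ℕ} (h01 : s0 + m ≤ s1) (h12 : s1 + m ≤ s2) (h23 : s2 + m ≤ s3)
    (h34 : s3 + m ≤ s4) (h4N : s4 + m ≤ N) (hm : Odd m) (hm3 : 3 ≤ m)
    (hK : 140737488355328 * ((D + D) * m.choose (m / 2)) ≤ 2 ^ m)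
    {P : CubeFn (ZMod 3) N} (hP : P ∈ lowDeg (ZMod 3) N D)
    (R : (Fin N → Bool) → Prop) [DecidablePred R]
    (hR0 : ∀ ρ (w w' : Fin m → Bool), R (joinAt s0 m ρ w) → R (joinAt s0 m ρ w'))
    (hR1 : ∀ ρ (w w' : Fin m → Bool), R (joinAt s1 m ρ w) → R (joinAt s1 m ρ w'))
    (hR2 : ∀ ρ (w w' : Fin m → Bool), R (joinAt s2 m ρ w) → R (joinAt s2 m ρ w'))
    (hR3 : ∀ ρ (w w' : Fin m → Bool), R (joinAt s3 m ρ w) → R (joinAt s3 m ρ w'))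
    (hR4 : ∀ ρ (w w' : Fin m → Bool), R (joinAt s4 m ρ w) → R (joinAt s4 m ρ w'))
    (τ0 τ1 τ2 τ3 τ4 : ZMod 3) (hτ0 : τ0 = 1 ∨ τ0 = -1) (hτ1 : τ1 = 1 ∨ τ1 = -1) (hτ2 : τ2 = 1 ∨ τ2 = -1)
    (hτ3 : τ3 = 1 ∨ τ3 = -1) (hτ4 : τ4 = 1 ∨ τ4 = -1) :
    140737488355328 * (32 * (univ.filter fun x => P x = 1 ∧ ((((R x ∧ bsgn s0 m x = τ0) ∧ bsgn s1 m x = τ1) ∧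
        bsgn s2 m x = τ2) ∧ bsgn s3 m x = τ3) ∧ bsgn s4 m x = τ4).card) ≤
      140737488355328 * (univ.filter fun x => P x = 1 ∧ R x).card + 31 * 2 ^ N := by
  obtain ⟨a0, -⟩ := step_two_sided (N := N) (s := s0) (m := m) (K := 140737488355328) (by omega) hm hm3 hK hP
    R hR0 τ0 hτ0
  obtain ⟨a1, -⟩ := step_two_sided (N := N) (s := s1) (m := m) (K := 140737488355328) (by omega) hm hm3 hK hP
    (fun x => R x ∧ bsgn s0 m x = τ0)
    (fun ρ w w' h => by
      rw [bsgn_joinAt_of_disjoint (s := s1) (m := m) (s' := s0) (m' := m) (Or.inl h01)] at h ⊢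
      exact ⟨hR1 ρ w w' h.1, h.2⟩) τ1 hτ1
  obtain ⟨a2, -⟩ := step_two_sided (N := N) (s := s2) (m := m) (K := 140737488355328) (by omega) hm hm3 hK hP
    (fun x => (R x ∧ bsgn s0 m x = τ0) ∧ bsgn s1 m x = τ1)
    (fun ρ w w' h => by
      rw [bsgn_joinAt_of_disjoint (s := s2) (m := m) (s' := s0) (m' := m) (Or.inl (by omega)),
        bsgn_joinAt_of_disjoint (s := s2) (m := m) (s' := s1) (m' := m) (Or.inl h12)] at h ⊢
      exact ⟨⟨hR2 ρ w w' h.1.1, h.1.2⟩, h.2⟩) τ2 hτ2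
  obtain ⟨a3, -⟩ := step_two_sided (N := N) (s := s3) (m := m) (K := 140737488355328) (by omega) hm hm3 hK hP
    (fun x => ((R x ∧ bsgn s0 m x = τ0) ∧ bsgn s1 m x = τ1) ∧ bsgn s2 m x = τ2)
    (fun ρ w w' h => by
      rw [bsgn_joinAt_of_disjoint (s := s3) (m := m) (s' := s0) (m' := m) (Or.inl (by omega)),
        bsgn_joinAt_of_disjoint (s := s3) (m := m) (s' := s1) (m' := m) (Or.inl (by omega)),
        bsgn_joinAt_of_disjoint (s := s3) (m := m) (s' := s2) (m' := m) (Or.inl h23)] at h ⊢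
      exact ⟨⟨⟨hR3 ρ w w' h.1.1.1, h.1.1.2⟩, h.1.2⟩, h.2⟩) τ3 hτ3
  obtain ⟨a4, -⟩ := step_two_sided (N := N) (s := s4) (m := m) (K := 140737488355328) (by omega) hm hm3 hK hP
    (fun x => (((R x ∧ bsgn s0 m x = τ0) ∧ bsgn s1 m x = τ1) ∧ bsgn s2 m x = τ2) ∧ bsgn s3 m x = τ3)
    (fun ρ w w' h => by
      rw [bsgn_joinAt_of_disjoint (s := s4) (m := m) (s' := s0) (m' := m) (Or.inl (by omega)),
        bsgn_joinAt_of_disjoint (s := s4) (m := m) (s' := s1) (m' := m) (Or.inl (by omega)),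
        bsgn_joinAt_of_disjoint (s := s4) (m := m) (s' := s2) (m' := m) (Or.inl (by omega)),
        bsgn_joinAt_of_disjoint (s := s4) (m := m) (s' := s3) (m' := m) (Or.inl h34)] at h ⊢
      exact ⟨⟨⟨⟨hR4 ρ w w' h.1.1.1.1, h.1.1.1.2⟩, h.1.1.2⟩, h.1.2⟩, h.2⟩) τ4 hτ4
  omega


end Chain5

end Summit.QuantumAdvantage.QuantumAdvantage.Theorems.AnchorDial

end
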